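import Mathlib

/-!
# Comparison principle for discrete Volterra (lower-triangular) inequalities (solo-blind s81, §24.91 J-tail)

In the J-tail step of the monodromy-box certificate the top-mode amplitude `u` of the coupled
head–tail chain obeys a *Volterra* inequality `u ≤ f + K u` on the node grid, with a nonnegative
kernel `K` that is lower-triangular (causality) and has diagonal `< 1` (the same-step term carries a
factor `h`).  A computed envelope `w` with `f + K w ≤ w` (a supersolution, verified in interval
arithmetic) then dominates `u`.  No sign condition on `u`, `f`, `w` is needed, and no smallness of
`K` beyond the diagonal: forward substitution.

* `volterra_comparison` — `u ≤ f + K u`, `f + K w ≤ w`, `K ≥ 0` lower-triangular with `K i i < 1`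
  imply `u ≤ w`.
-/

namespace Summit.AnomalousDissipation.AnomalousDissipation.Theorems

open Finset

/-- Splitting a lower-triangular kernel sum into the strictly-lower part and the diagonal term. -/
theorem lowerTriangular_sum_split {n : ℕ} (K : Fin n → Fin n → ℝ)
    (htri : ∀ i j, i < j → K i j = 0) (v : Fin n → ℝ) (i : Fin n) :
    ∑ j, K i j * v j = (∑ j, if j < i then K i j * v j else 0) + K i i * v i := by
  have hpt : ∀ j, K i j * v j =
      (if j < i then K i j * v j else 0) + (if j = i then K i i * v i else 0) := by
    intro j
    rcases lt_trichotomy j i with h | h | h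
    · simp [h, h.ne]
    · subst h; rw [if_neg (lt_irrefl _), if_pos rfl, zero_add]
    · have h1 : ¬ j < i := not_lt.mpr h.le
      simp [h1, h.ne', htri i j h]
  rw [Finset.sum_congr rfl (fun j _ => hpt j), sum_add_distrib]
  congr 1
  rw [Finset.sum_ite_eq' univ i]
  simp

/-- **Comparison principle for discrete Volterra inequalities.**  Let `K ≥ 0` be lower-triangular
with diagonal entries `< 1`.  If `u ≤ f + K u` and `f + K w ≤ w` (pointwise), then `u ≤ w`. -/
theorem volterra_comparison {n : ℕ} (K : Fin n → Fin n → ℝ) (u f w : Fin n → ℝ)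
    (hK : ∀ i j, 0 ≤ K i j) (htri : ∀ i j, i < j → K i j = 0) (hdiag : ∀ i, K i i < 1)
    (hu : ∀ i, u i ≤ f i + ∑ j, K i j * u j) (hw : ∀ i, f i + ∑ j, K i j * w j ≤ w i) :
    ∀ i, u i ≤ w i := by
  suffices H : ∀ k : ℕ, ∀ i : Fin n, (i : ℕ) < k → u i ≤ w i from
    fun i => H ((i : ℕ) + 1) i (Nat.lt_succ_self _)
  intro k
  induction k with
  | zero => intro i hi; exact absurd hi (Nat.not_lt_zero _)
  | succ k ih =>
    intro i hi
    have hui := hu i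
    have hwi := hw i
    rw [lowerTriangular_sum_split K htri u i] at hui
    rw [lowerTriangular_sum_split K htri w i] at hwi
    have hS : (∑ j, if j < i then K i j * u j else 0) ≤ ∑ j, if j < i then K i j * w j else 0 := by
      apply sum_le_sum
      intro j _
      split_ifs with hji
      · have hj : (j : ℕ) < k := by
          have := Fin.lt_def.mp hji
          omega
        exact mul_le_mul_of_nonneg_left (ih j hj) (hK i j)
      · exact le_refl _
    have hpos : 0 < 1 - K i i := by linarith [hdiag i]
    have h1 : (1 - K i i) * u i ≤ f i + ∑ j, if j < i then K i j * w j else 0 := by nlinarith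
    have h2 : f i + (∑ j, if j < i then K i j * w j else 0) ≤ (1 - K i i) * w i := by nlinarith
    have h3 : (1 - K i i) * u i ≤ (1 - K i i) * w i := le_trans h1 h2
    exact le_of_mul_le_mul_left h3 hpos

end Summit.AnomalousDissipation.AnomalousDissipation.Theorems
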